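import Summits.Ventures.PercRepro.Night2TwoOneGeneralCell
import Summits.Ventures.PercRepro.Night2ThreeTwoNineTen

/-!
# PercRepro — **THE `(7, 5)` SHADOW ROW MODULO THE RESIDUES `(2, 0)`, `(2, 1)`: EVERY `(2, 1)` CELL WITH EXACTLY
TWO FAT CLOSURES IS CLOSED** (night-2, gen 28)

`shadowHall_seven_five_of_residuesZ''` (`Night2ThreeTwoNineTen`) left the `(2, 1)` residue «two fat closures OR a
thin member missing `3 … 6` points».  `localShadowHall_two_one_five_fatClosures_general` settles every cell with
EXACTLY two fat closures, at every `|V|`, with no spread hypothesis.  So the `(2, 1)` residue shrinks to: «a thin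
member missing `3 … 6` points AND at most one fat closure, OR at least three fat closures» —
**`shadowHall_seven_five_of_residuesZ4`**, the row of record.
-/

namespace PercRepro.Shadow

open Finset PerFlat ThmH

section SevenFiveZ4

variable {α' : Type} [DecidableEq α']

open scoped Classical in
/-- **THE `(7, 5)` SHADOW ROW FOR EVERY FINITE MATROID MODULO THE RESIDUES `(2, 0)`, `(2, 1)`, THE LATTER WITHOUT
ITS TWO-FAT-CLOSURE CELLS**: the `(2, 1)` clause now reads «a thin member missing `3 … 6` points with at most one
fat closure, or at least three fat closures». -/
theorem shadowHall_seven_five_of_residuesZ4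
    (h20 : ∀ (N : Matroid α') [N.Finite] (G : Finset α'), CellHyp N G →
      (gr N \ G).card = 2 → kColoops N G = 0 → FatMember N G 6 3 →
      (FatBasis N G 6 2 ∨ FatMember N G 6 2) →
      (2 ≤ (fatClosures N 5 G 2).card ∨
        ∃ B ∈ thinMembers N 5 G, 2 < (G \ clF N B).card ∧ (G \ clF N B).card < 5) →
      LocalShadowHall N 5 G)
    (h21 : ∀ (N : Matroid α') [N.Finite] (G : Finset α'), CellHyp N G →
      (gr N \ G).card = 2 → kColoops N G = 1 → FatMember N G 5 4 →
      (FatBasis N G 5 3 ∨ FatMember N G 5 3) →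
      (((∃ B ∈ thinMembers N 5 G, 2 < (G \ clF N B).card ∧ (G \ clF N B).card < 7) ∧
          (fatClosures N 5 G 2).card ≤ 1) ∨
        3 ≤ (fatClosures N 5 G 2).card) →
      LocalShadowHall N 5 G)
    (M : Matroid α') [M.Finite] : ShadowHall M 7 5 (phiK 7 5) := by
  apply shadowHall_seven_five_of_residuesZ'' h20
  intro N _ G hcell hd hk hfm hfb hH
  by_cases h3 : 3 ≤ (fatClosures N 5 G 2).card
  · exact h21 N G hcell hd hk hfm hfb (Or.inr h3)
  · by_cases h2 : 2 ≤ (fatClosures N 5 G 2).card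
    · exact localShadowHall_two_one_five_fatClosures_general hcell.2.2.2 hd hk hcell.1 hcell.2.1 h2 (by omega)
    · rcases hH with hfat2 | hmid
      · exact absurd hfat2 h2
      · exact h21 N G hcell hd hk hfm hfb (Or.inl ⟨hmid, by omega⟩)

end SevenFiveZ4

end PercRepro.Shadow
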